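import Summits.QuantumAdvantage.QuantumAdvantage.Theses.LinnikCubicClassGroups
import Summits.QuantumAdvantage.QuantumAdvantage.Theorems.LinnikCubicClassGroupsPureCubicClassGroupFBQPStubRegulatorPeriod

/-!
# Crux `LinnikCubicClassGroups.PureCubicClassGroupFBQP` (stmt-QuantumAdvantage-11544) — stub `stub_regulator`, helper: admissible fields

Helper for the transfer clause of sub-goal SG-A of stub `stub_regulator` (line arakelov-giant-step-cycle):
every ADMISSIBLE field of the crux — a number field `K` of degree `3` containing `α` with `α³ = m`,
`m ∈ ℕ` not a cube — is generated by `α`, has minimal polynomial `X³ − m`, a real embedding `σ₁` with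
`σ₁ α > 0` and a non-real embedding `σ₂`; so the chain theorem `voronoiChain` and S2 apply to it.
-/

namespace Summit.QuantumAdvantage.QuantumAdvantage.Theorems.LinnikCubicClassGroups

open scoped NumberField ComplexConjugate
open NumberField Polynomial

/-- **`X³ − m` is irreducible over `ℚ` when `m` is not a cube** (rational root theorem, via
`irrational_nrt_of_notint_nrt`). -/
theorem irreducible_X_pow_three_sub_C {m : ℕ} (hm : ∀ r : ℕ, r ^ 3 ≠ m) :
    Irreducible (X ^ 3 - C (m : ℚ) : ℚ[X]) := by
  have hdeg : (X ^ 3 - C (m : ℚ) : ℚ[X]).natDegree = 3 := natDegree_X_pow_sub_C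
  refine Polynomial.irreducible_of_degree_le_three_of_not_isRoot (by rw [hdeg]; decide) fun q hq => ?_
  have hq3 : (q : ℝ) ^ 3 = ((m : ℤ) : ℝ) := by
    have h : q ^ 3 = m := by
      have := hq
      rw [IsRoot, eval_sub, eval_pow, eval_X, eval_C, sub_eq_zero] at this
      exact this
    push_cast
    exact_mod_cast congrArg (fun x : ℚ => (x : ℝ)) h
  have hv : ¬ ∃ y : ℤ, (q : ℝ) = y := by
    rintro ⟨y, hy⟩
    rw [hy] at hq3
    have hy3 : y ^ 3 = m := by exact_mod_cast hq3
    have hy0 : 0 ≤ y := by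
      by_contra hneg
      push Not at hneg
      have : y ^ 3 < 0 := Odd.pow_neg (by decide) hneg
      rw [hy3] at this
      exact absurd this (not_lt.mpr (Int.natCast_nonneg m))
    obtain ⟨n, rfl⟩ := Int.eq_ofNat_of_zero_le hy0
    exact hm n (by exact_mod_cast hy3)
  exact (irrational_nrt_of_notint_nrt 3 m hq3 hv (by norm_num)) ⟨q, rfl⟩

variable {K : Type} [Field K] [NumberField K]

/-- Two complex embeddings agreeing on a generator are equal. -/
theorem ringHom_ext_of_adjoin_eq_top {α : K} (htop : IntermediateField.adjoin ℚ {α} = ⊤)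
    {φ ψ : K →+* ℂ} (h : φ α = ψ α) : φ = ψ := by
  ext y
  have hy : y ∈ IntermediateField.adjoin ℚ {α} := by rw [htop]; exact IntermediateField.mem_top
  exact IntermediateField.adjoin_induction (F := ℚ) (p := fun y _ => φ y = ψ y)
    (fun x hx => by rw [Set.mem_singleton_iff] at hx; subst hx; exact h)
    (fun q => by simp)
    (fun x y _ _ hx hy => by rw [map_add, map_add, hx, hy])
    (fun x _ hx => by rw [map_inv₀, map_inv₀, hx])
    (fun x y _ _ hx hy => by rw [map_mul, map_mul, hx, hy]) hy

/-- **Admissible fields have signature (1,1) and are generated by the cube root.** For a number field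
`K` of degree `3`, `m ∈ ℕ` not a cube and `α ∈ K` with `α³ = m`: `minpoly ℚ α = X³ − m`, `K = ℚ(α)`,
and there are a real embedding `σ₁` with `σ₁ α > 0` (the real cube root) and a non-real embedding `σ₂`
(`α ↦ e^{2πi/3} ∛m`). -/
theorem admissible_structure (hdeg : Module.finrank ℚ K = 3) {m : ℕ} (hm : ∀ r : ℕ, r ^ 3 ≠ m)
    {α : K} (hα : α ^ 3 = (m : K)) :
    minpoly ℚ α = X ^ 3 - C (m : ℚ) ∧ IntermediateField.adjoin ℚ {α} = ⊤ ∧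
      ∃ (σ₁ : K →+* ℝ) (σ₂ : K →+* ℂ), (∃ z : K, starRingEnd ℂ (σ₂ z) ≠ σ₂ z) ∧ 0 < σ₁ α := by
  have hirr := irreducible_X_pow_three_sub_C hm
  have hmonic : (X ^ 3 - C (m : ℚ) : ℚ[X]).Monic := monic_X_pow_sub_C _ (by norm_num)
  have haeval : aeval α (X ^ 3 - C (m : ℚ) : ℚ[X]) = 0 := by
    simp [hα]
  have hmin : minpoly ℚ α = X ^ 3 - C (m : ℚ) := (minpoly.eq_of_irreducible_of_monic hirr haeval hmonic).symm
  have htop : IntermediateField.adjoin ℚ {α} = ⊤ := by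
    rw [Field.primitive_element_iff_minpoly_natDegree_eq, hmin, natDegree_X_pow_sub_C, hdeg]
  refine ⟨hmin, htop, ?_⟩
  -- `m > 0`
  have hm0 : 0 < m := Nat.pos_of_ne_zero fun h => hm 0 (by rw [h]; norm_num)
  -- the real cube root
  set r : ℝ := (m : ℝ) ^ ((1 : ℝ) / 3) with hr
  have hr0 : 0 < r := Real.rpow_pos_of_pos (by exact_mod_cast hm0) _
  have hr3 : r ^ 3 = m := by
    rw [hr, ← Real.rpow_natCast, ← Real.rpow_mul (Nat.cast_nonneg m)]
    norm_num
  -- roots of the minimal polynomial are values of embeddings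
  have hroot : ∀ z : ℂ, z ^ 3 = m → ∃ φ : K →+* ℂ, φ α = z := by
    intro z hz
    have hmem : z ∈ (minpoly ℚ α).rootSet ℂ := by
      rw [hmin, Polynomial.mem_rootSet]
      refine ⟨hmonic.ne_zero, ?_⟩
      simp [hz]
    rw [← NumberField.Embeddings.range_eval_eq_rootSet_minpoly] at hmem
    obtain ⟨φ, hφ⟩ := hmem
    exact ⟨φ, hφ⟩
  -- the real embedding
  obtain ⟨φ₁, hφ₁⟩ := hroot (r : ℂ) (by exact_mod_cast hr3)
  have hreal : ComplexEmbedding.IsReal φ₁ := by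
    rw [ComplexEmbedding.isReal_iff]
    exact ringHom_ext_of_adjoin_eq_top htop
      (by rw [ComplexEmbedding.conjugate_coe_eq, hφ₁, Complex.conj_ofReal])
  -- the non-real embedding
  set ω : ℂ := Complex.exp (2 * Real.pi * Complex.I / 3) with hω
  have hprim : IsPrimitiveRoot ω 3 := by
    have := Complex.isPrimitiveRoot_exp 3 (by norm_num)
    simpa [hω] using this
  obtain ⟨φ₂, hφ₂⟩ := hroot ((r : ℂ) * ω) (by
    rw [mul_pow, hprim.pow_eq_one, mul_one]; exact_mod_cast hr3)
  have hωnr : starRingEnd ℂ ω ≠ ω := by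
    intro hc
    have him : ω.im = 0 := by
      have := congrArg Complex.im hc
      rw [Complex.conj_im] at this
      linarith
    have hωre : ω = (ω.re : ℂ) := Complex.ext rfl (by simp [him])
    have hre3 : ω.re ^ 3 = 1 := by
      have h1 := hprim.pow_eq_one
      rw [hωre] at h1
      exact_mod_cast h1
    have hre1 : ω.re = 1 :=
      (Odd.pow_injective (by decide : Odd 3)) (show ω.re ^ 3 = 1 ^ 3 by rw [hre3, one_pow])
    exact hprim.ne_one (by norm_num) (by rw [hωre, hre1]; simp)
  refine ⟨hreal.embedding, φ₂, ⟨α, ?_⟩, ?_⟩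
  · rw [hφ₂, map_mul, Complex.conj_ofReal]
    intro hc
    exact hωnr (mul_left_cancel₀ (by exact_mod_cast hr0.ne') hc)
  · have h1 : ((hreal.embedding α : ℝ) : ℂ) = (r : ℂ) := by
      rw [ComplexEmbedding.IsReal.coe_embedding_apply, hφ₁]
    rw [Complex.ofReal_inj.mp h1]
    exact hr0

/-- **Two admissible fields are isomorphic by an isomorphism matching the cube roots.** -/
theorem exists_algEquiv_of_admissible {K' : Type} [Field K'] [NumberField K']
    (hdeg : Module.finrank ℚ K = 3) (hdeg' : Module.finrank ℚ K' = 3) {m : ℕ} (hm : ∀ r : ℕ, r ^ 3 ≠ m)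
    {α : K} (hα : α ^ 3 = (m : K)) {α' : K'} (hα' : α' ^ 3 = (m : K')) :
    ∃ e : K ≃ₐ[ℚ] K', e α = α' := by
  obtain ⟨hmin, htop, -⟩ := admissible_structure hdeg hm hα
  have hint : IsIntegral ℚ α := IsIntegral.of_finite ℚ α
  have hroot : α' ∈ (minpoly ℚ α).aroots K' := by
    rw [Polynomial.mem_aroots, hmin]
    refine ⟨(monic_X_pow_sub_C _ (by norm_num)).ne_zero, ?_⟩
    simp [hα']
  set f₀ : IntermediateField.adjoin ℚ {α} →ₐ[ℚ] K' :=
    (IntermediateField.algHomAdjoinIntegralEquiv ℚ hint).symm ⟨α', hroot⟩ with hf₀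
  have hf₀gen : f₀ (IntermediateField.AdjoinSimple.gen ℚ α) = α' :=
    IntermediateField.algHomAdjoinIntegralEquiv_symm_apply_gen ℚ hint ⟨α', hroot⟩
  set e₀ : IntermediateField.adjoin ℚ {α} ≃ₐ[ℚ] K :=
    (IntermediateField.equivOfEq htop).trans IntermediateField.topEquiv with he₀
  set f : K →ₐ[ℚ] K' := f₀.comp e₀.symm.toAlgHom with hf
  have hfα : f α = α' := by
    have hgen : e₀.symm α = IntermediateField.AdjoinSimple.gen ℚ α := by
      apply e₀.injective
      rw [AlgEquiv.apply_symm_apply]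
      rfl
    rw [hf, AlgHom.comp_apply]
    change f₀ (e₀.symm α) = α'
    rw [hgen, hf₀gen]
  have hinj : Function.Injective f.toLinearMap := f.toRingHom.injective
  have hsurj : Function.Surjective f.toLinearMap :=
    (LinearMap.injective_iff_surjective_of_finrank_eq_finrank (by rw [hdeg, hdeg'])).mp hinj
  exact ⟨AlgEquiv.ofBijective f ⟨hinj, hsurj⟩, by rw [AlgEquiv.ofBijective_apply, hfα]⟩

/-- **An admissible field has exactly one real embedding** (it is generated by `α`, and cubing is
injective on `ℝ`). -/
theorem realEmbedding_eq (hdeg : Module.finrank ℚ K = 3) {m : ℕ} (hm : ∀ r : ℕ, r ^ 3 ≠ m)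
    {α : K} (hα : α ^ 3 = (m : K)) (σ τ : K →+* ℝ) : σ = τ := by
  obtain ⟨-, htop, -⟩ := admissible_structure hdeg hm hα
  have h3 : σ α ^ 3 = τ α ^ 3 := by rw [← map_pow, ← map_pow, hα]; simp
  have heq : σ α = τ α := (Odd.pow_injective (by decide : Odd 3)) h3
  have hc : (algebraMap ℝ ℂ).comp σ = (algebraMap ℝ ℂ).comp τ :=
    ringHom_ext_of_adjoin_eq_top htop (by simp [heq])
  ext x
  have := RingHom.congr_fun hc x
  simpa using this

/-- **All admissible fields have the same regulator** (from S2: the regulator is the logarithm of the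
least unit above `1` at the real place, and isomorphic fields matched at the cube root have matching
real places and matching units). -/
theorem regulator_eq_of_admissible
    (h2 : ∀ (K : Type) [Field K] [NumberField K], Module.finrank ℚ K = 3 →
      ∀ (σ₁ : K →+* ℝ) (σ₂ : K →+* ℂ), (∃ z : K, starRingEnd ℂ (σ₂ z) ≠ σ₂ z) →
      ∃ ε : (𝓞 K)ˣ, 1 < σ₁ ((ε : 𝓞 K) : K) ∧
        Real.log (σ₁ ((ε : 𝓞 K) : K)) = NumberField.Units.regulator K ∧
        ∀ u : (𝓞 K)ˣ, 1 < σ₁ ((u : 𝓞 K) : K) → σ₁ ((ε : 𝓞 K) : K) ≤ σ₁ ((u : 𝓞 K) : K))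
    {K' : Type} [Field K'] [NumberField K']
    (hdeg : Module.finrank ℚ K = 3) (hdeg' : Module.finrank ℚ K' = 3) {m : ℕ} (hm : ∀ r : ℕ, r ^ 3 ≠ m)
    {α : K} (hα : α ^ 3 = (m : K)) {α' : K'} (hα' : α' ^ 3 = (m : K')) :
    NumberField.Units.regulator K = NumberField.Units.regulator K' := by
  obtain ⟨-, -, σ₁, σ₂, hσ₂, -⟩ := admissible_structure hdeg hm hα
  obtain ⟨-, -, σ₁', σ₂', hσ₂', -⟩ := admissible_structure hdeg' hm hα'
  obtain ⟨e, -⟩ := exists_algEquiv_of_admissible hdeg hdeg' hm hα hα'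
  -- the real places correspond under `e`
  have hστ : σ₁ = σ₁'.comp e.toRingEquiv.toRingHom := realEmbedding_eq hdeg hm hα _ _
  have hσe : ∀ x : K, σ₁ x = σ₁' (e x) := fun x => by rw [hστ]; rfl
  have hσe' : ∀ y : K', σ₁' y = σ₁ (e.symm y) := fun y => by rw [hσe, AlgEquiv.apply_symm_apply]
  -- units correspond
  set E : 𝓞 K ≃+* 𝓞 K' := NumberField.RingOfIntegers.mapRingEquiv e.toRingEquiv with hE
  obtain ⟨ε, hε1, hreg, hleast⟩ := h2 K hdeg σ₁ σ₂ hσ₂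
  obtain ⟨ε', hε1', hreg', hleast'⟩ := h2 K' hdeg' σ₁' σ₂' hσ₂'
  have hmap : ∀ u : (𝓞 K)ˣ, σ₁' (((Units.map E.toMonoidHom u : (𝓞 K')ˣ) : 𝓞 K') : K') = σ₁ ((u : 𝓞 K) : K) :=
    fun u => by rw [hσe]; rfl
  have hmap' : ∀ u : (𝓞 K')ˣ, σ₁ (((Units.map E.symm.toMonoidHom u : (𝓞 K)ˣ) : 𝓞 K) : K) = σ₁' ((u : 𝓞 K') : K') :=
    fun u => by rw [hσe']; rfl
  have h1 : σ₁' ((ε' : 𝓞 K') : K') ≤ σ₁ ((ε : 𝓞 K) : K) := by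
    have := hleast' (Units.map E.toMonoidHom ε) (by rw [hmap]; exact hε1)
    rwa [hmap] at this
  have h2' : σ₁ ((ε : 𝓞 K) : K) ≤ σ₁' ((ε' : 𝓞 K') : K') := by
    have := hleast (Units.map E.symm.toMonoidHom ε') (by rw [hmap']; exact hε1')
    rwa [hmap'] at this
  rw [← hreg, ← hreg', le_antisymm h2' h1]

/-- **S3c `stub_admissibleFields`** (registered stub of the skeleton `Lines/arakelov-giant-step-cycle.lean` of crux
stmt-QuantumAdvantage-11544): for a non-cube `m`, any two cubic number fields with cube roots `α`, `α'` of `m` are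
`ℚ`-isomorphic by an isomorphism sending `α ↦ α'`, and they have the same regulator (the landed S2
`stub_regulatorPeriod` supplies the least-unit description of the regulator). -/
theorem stub_admissibleFields : ∀ m : ℕ, (∀ r : ℕ, r ^ 3 ≠ m) →
      ∀ (K : Type) [Field K] [NumberField K] (K' : Type) [Field K'] [NumberField K'],
        Module.finrank ℚ K = 3 → Module.finrank ℚ K' = 3 →
        ∀ (α : K) (α' : K'), α ^ 3 = (m : K) → α' ^ 3 = (m : K') →
        (∃ e : K ≃ₐ[ℚ] K', e α = α') ∧ NumberField.Units.regulator K = NumberField.Units.regulator K' := by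
  intro m hm K _ _ K' _ _ hdeg hdeg' α α' hα hα'
  exact ⟨exists_algEquiv_of_admissible hdeg hdeg' hm hα hα',
    regulator_eq_of_admissible stub_regulatorPeriod hdeg hdeg' hm hα hα'⟩

end Summit.QuantumAdvantage.QuantumAdvantage.Theorems.LinnikCubicClassGroups
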